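import Mathlib.RingTheory.Derivation.Basic
import Mathlib.RingTheory.RegularLocalRing.Defs
import Literature.AlgebraicGeometry.Resolution.RegularLocalRingsProofs

/-!
# Giraud's Lemme 2.3 (iii): the core commutator step

Crux `Valuative.LuAlphaPTorsor`, line `pfaff-line-log-final-forms`.

Helper file for the stub `mem_maximalIdeal_of_sub_mul_mem_sq` (V2) of the line
`pfaff-line-log-final-forms` (item `stmt-ResolutionOfSingularities-0641`).

Let `R` be a regular local ring with `𝔪 = (x, y)`, `x ≠ 0`, and let `Dy` be a derivation with
`Dy x = 0`, `Dy y = 1` (the dual derivation of `y`). Suppose every `{x}`-logarithmic derivation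
`δ` (`δ x ∈ (x)`) satisfies `δ f ∈ (x ^ a) 𝔪`, and let `Δ` be `{x, y}`-logarithmic with
`Δ f = x ^ a φ`. Then the order-one part of `φ` is never a unit multiple of `y`: if
`φ ≡ c y mod 𝔪 ²` then `c ∈ 𝔪`.

The argument is `p`-basis free: the commutator `Θ = [Dy, Δ]` is again `{x}`-logarithmic, so
`Θ f ∈ (x ^ a) 𝔪`; also `Δ (Dy f) ∈ (x ^ a) 𝔪` (`Dy f = x ^ a B`, `B ∈ 𝔪`, `Δ 𝔪 ⊆ 𝔪`,
`Δ (x ^ a) ∈ (x ^ a)`), whence `x ^ a Dy φ = Dy (Δ f) = Θ f + Δ (Dy f) ∈ (x ^ a) 𝔪`; cancelling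
`x ^ a` in the domain `R` gives `Dy φ ∈ 𝔪`, and `Dy φ ≡ c mod 𝔪` because `Dy (𝔪 ²) ⊆ 𝔪`.

The registered signature quantifies over `Derivation ℤ R R` under a variable `[Algebra ℤ R]`,
so the `ℤ`-module structure on `R` is `AddCommGroup.toIntModule`, not `Algebra.toModule`; the
Lie bracket of `Mathlib.RingTheory.Derivation.Lie` is therefore not available on this type and the
commutator is rebuilt with `Derivation.mk'` (`exists_commutator`).

* `exists_commutator` — the commutator `[D₁, D₂]` of two derivations is a derivation;
* `apply_pow_mem_span_pow` — `δ x ∈ (x) ⇒ δ (x ^ n) ∈ (x ^ n)`;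
* `apply_mem_of_span_pair_eq` — an `{x, y}`-logarithmic derivation preserves `(x, y)`;
* `apply_mem_of_mem_sq` — `δ (P ²) ⊆ P`;
* `mem_maximalIdeal_of_sub_mul_mem_sq` — the statement above (registered signature).
-/

set_option linter.dupNamespace false

open IsLocalRing Literature.AlgebraicGeometry.Resolution

namespace Summit.ResolutionOfSingularities.ResolutionOfSingularities.Theorems.PfaffLine

section GiraudIII

variable {R : Type*} [CommRing R] [Algebra ℤ R]

/-- The commutator `[D₁, D₂] = D₁ ∘ D₂ - D₂ ∘ D₁` of two derivations is a derivation (rebuilt with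
`Derivation.mk'` for the instance arguments of the registered signature). [folklore] -/
theorem exists_commutator (D₁ D₂ : Derivation ℤ R R) :
    ∃ Θ : Derivation ℤ R R, ∀ a, Θ a = D₁ (D₂ a) - D₂ (D₁ a) :=
  ⟨Derivation.mk'
      ((D₁.toLinearMap : R →ₗ[ℤ] R) ∘ₗ D₂.toLinearMap -
        (D₂.toLinearMap : R →ₗ[ℤ] R) ∘ₗ D₁.toLinearMap)
      fun a b => by
        simp only [LinearMap.sub_apply, LinearMap.coe_comp, Function.comp_apply,
          LinearMap.coe_restrictScalars, Derivation.coeFn_coe, Derivation.leibniz, smul_eq_mul,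
          map_add]
        ring,
    fun _ => rfl⟩

/-- If `δ x ∈ (x)` then `δ (x ^ n) ∈ (x ^ n)` for every `n`. [folklore] -/
theorem apply_pow_mem_span_pow (δ : Derivation ℤ R R) {x : R} (hx : δ x ∈ Ideal.span {x}) :
    ∀ n : ℕ, δ (x ^ n) ∈ Ideal.span {x ^ n}
  | 0 => by simp
  | n + 1 => by
    have ih := apply_pow_mem_span_pow δ hx n
    rw [Ideal.mem_span_singleton] at hx ih ⊢
    rw [pow_succ, Derivation.leibniz, smul_eq_mul, smul_eq_mul]
    refine dvd_add (mul_dvd_mul_left _ hx) ?_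
    rw [mul_comm (x ^ n) x]
    exact mul_dvd_mul_left x ih

/-- A derivation `Δ` with `Δ x ∈ (x)` and `Δ y ∈ (y)` maps the ideal `I = (x, y)` into itself:
for `z = a x + b y`, `Δ z = a Δ x + x Δ a + b Δ y + y Δ b ∈ I`. [folklore] -/
theorem apply_mem_of_span_pair_eq {x y : R} {I : Ideal R} (hxy : Ideal.span {x, y} = I)
    (Δ : Derivation ℤ R R) (hΔx : Δ x ∈ Ideal.span {x}) (hΔy : Δ y ∈ Ideal.span {y}) {z : R}
    (hz : z ∈ I) : Δ z ∈ I := by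
  subst hxy
  obtain ⟨a, b, rfl⟩ := Ideal.mem_span_pair.mp hz
  have hx : x ∈ Ideal.span {x, y} := Ideal.subset_span (Set.mem_insert _ _)
  have hy : y ∈ Ideal.span {x, y} := Ideal.subset_span (Set.mem_insert_of_mem _ rfl)
  have hΔx' : Δ x ∈ Ideal.span {x, y} := (Ideal.span_singleton_le_iff_mem _).mpr hx hΔx
  have hΔy' : Δ y ∈ Ideal.span {x, y} := (Ideal.span_singleton_le_iff_mem _).mpr hy hΔy
  rw [map_add, Derivation.leibniz, Derivation.leibniz, smul_eq_mul, smul_eq_mul, smul_eq_mul,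
    smul_eq_mul]
  exact Ideal.add_mem _
    (Ideal.add_mem _ (Ideal.mul_mem_left _ _ hΔx') (Ideal.mul_mem_right _ _ hx))
    (Ideal.add_mem _ (Ideal.mul_mem_left _ _ hΔy') (Ideal.mul_mem_right _ _ hy))

/-- Leibniz: a derivation maps `P ²` into `P` (`δ (m n) = m δ n + n δ m`). [folklore] -/
theorem apply_mem_of_mem_sq (δ : Derivation ℤ R R) (P : Ideal R) {q : R} (hq : q ∈ P ^ 2) :
    δ q ∈ P := by
  rw [pow_two] at hq
  refine Submodule.mul_induction_on hq (fun m hm n hn => ?_) (fun u v hu hv => ?_)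
  · rw [Derivation.leibniz, smul_eq_mul, smul_eq_mul]
    exact P.add_mem (P.mul_mem_right _ hm) (P.mul_mem_right _ hn)
  · rw [map_add]
    exact P.add_mem hu hv

end GiraudIII

/-- **Giraud 1983, Lemme 2.3 (iii), core step (commutator argument).** Let `R` be a regular
local ring with `𝔪 = (x, y)`, `x ≠ 0`, `Dy` a derivation with `Dy x = 0`, `Dy y = 1`, and
suppose every derivation `δ` with `δ x ∈ (x)` has `δ f ∈ (x ^ a) 𝔪`. If `Δ` is
`{x, y}`-logarithmic with `Δ f = x ^ a φ` and `φ ≡ c y mod 𝔪 ²`, then `c ∈ 𝔪`.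
Proof: `Θ = [Dy, Δ]` has `Θ x = x · Dy r ∈ (x)` (`Δ x = r x`), so `Θ f ∈ (x ^ a) 𝔪`; with
`Dy f = x ^ a B`, `B ∈ 𝔪`, also `Δ (Dy f) = x ^ a Δ B + B Δ (x ^ a) ∈ (x ^ a) 𝔪`; hence
`x ^ a Dy φ = Dy (Δ f) = Θ f + Δ (Dy f) ∈ (x ^ a) 𝔪`, so `Dy φ ∈ 𝔪` (`R` is a domain), while
`Dy φ ≡ c mod 𝔪` since `Dy (𝔪 ²) ⊆ 𝔪`. Source: J. Giraud, *Forme normale d'une fonction sur une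
surface de caractéristique positive*, Bull. SMF 111 (1983), Lemme 2.3 (iii). [folklore] -/
theorem mem_maximalIdeal_of_sub_mul_mem_sq : ∀ {R : Type*} [CommRing R] [Algebra ℤ R] [IsRegularLocalRing R] (x y : R), Ideal.span {x, y} = maximalIdeal R → x ≠ 0 → ∀ (Dy : Derivation ℤ R R), Dy x = 0 → Dy y = 1 → ∀ (f : R) (a : ℕ), (∀ δ : Derivation ℤ R R, δ x ∈ Ideal.span {x} → δ f ∈ Ideal.span {x ^ a} * maximalIdeal R) → ∀ (Δ : Derivation ℤ R R) (φ : R), Δ x ∈ Ideal.span {x} → Δ y ∈ Ideal.span {y} → Δ f = x ^ a * φ → ∀ c : R, φ - c * y ∈ maximalIdeal R ^ 2 → c ∈ maximalIdeal R := by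
  intro R _ _ _ x y hxy hx Dy hDyx hDyy f a h1 Δ φ hΔx hΔy hΔf c hc
  haveI : IsDomain R := isDomain_of_isRegularLocalRing R
  have hym : y ∈ maximalIdeal R := by
    rw [← hxy]; exact Ideal.subset_span (Set.mem_insert_of_mem _ rfl)
  -- (1) `Δ 𝔪 ⊆ 𝔪`
  have hΔm : ∀ z ∈ maximalIdeal R, Δ z ∈ maximalIdeal R := fun z hz =>
    apply_mem_of_span_pair_eq hxy Δ hΔx hΔy hz
  -- (2) `Dy f = x ^ a * B` with `B ∈ 𝔪`
  obtain ⟨B, hB, hDyf⟩ : ∃ B ∈ maximalIdeal R, x ^ a * B = Dy f :=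
    Ideal.mem_span_singleton_mul.mp (h1 Dy (by rw [hDyx]; exact Ideal.zero_mem _))
  -- (3) the commutator `Θ := [Dy, Δ]` is `{x}`-logarithmic, hence `Θ f ∈ (x ^ a) 𝔪`
  obtain ⟨Θ, hΘ⟩ := exists_commutator Dy Δ
  obtain ⟨r, hr⟩ := Ideal.mem_span_singleton'.mp hΔx
  have hΘx : Θ x ∈ Ideal.span {x} := by
    rw [hΘ, hDyx, map_zero, sub_zero, ← hr, Derivation.leibniz, hDyx, smul_zero, zero_add,
      smul_eq_mul]
    exact Ideal.mul_mem_right _ _ (Ideal.mem_span_singleton_self x)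
  have hΘf : Θ f ∈ Ideal.span {x ^ a} * maximalIdeal R := h1 _ hΘx
  -- (4a) `Dy (Δ f) = x ^ a * Dy φ` since `Dy x = 0`
  have h4a : Dy (Δ f) = x ^ a * Dy φ := by
    rw [hΔf, Derivation.leibniz, Derivation.leibniz_pow, hDyx]
    simp
  -- (4b) `Δ (Dy f) = x ^ a * Δ B + B * Δ (x ^ a) ∈ (x ^ a) 𝔪`
  have h4b : Δ (Dy f) ∈ Ideal.span {x ^ a} * maximalIdeal R := by
    rw [← hDyf, Derivation.leibniz, smul_eq_mul, smul_eq_mul]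
    refine Ideal.add_mem _ (Ideal.mul_mem_mul (Ideal.mem_span_singleton_self _) (hΔm B hB)) ?_
    rw [mul_comm B]
    exact Ideal.mul_mem_mul (apply_pow_mem_span_pow Δ hΔx a) hB
  -- (4) hence `x ^ a * Dy φ = Θ f + Δ (Dy f) ∈ (x ^ a) 𝔪`
  have h4 : x ^ a * Dy φ ∈ Ideal.span {x ^ a} * maximalIdeal R := by
    have e : x ^ a * Dy φ = Θ f + Δ (Dy f) := by
      rw [← h4a, hΘ, sub_add_cancel]
    rw [e]
    exact Ideal.add_mem _ hΘf h4b
  -- (5) cancel `x ^ a ≠ 0` in the domain `R`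
  have h5 : Dy φ ∈ maximalIdeal R := by
    obtain ⟨w, hw, hwe⟩ := Ideal.mem_span_singleton_mul.mp h4
    exact mul_left_cancel₀ (pow_ne_zero a hx) hwe ▸ hw
  -- (6) `Dy φ = c + y * Dy c + Dy q` with `q = φ - c * y ∈ 𝔪 ²`, `Dy q ∈ 𝔪`
  have hq : Dy (φ - c * y) ∈ maximalIdeal R := apply_mem_of_mem_sq Dy _ hc
  have e : c = Dy φ - y * Dy c - Dy (φ - c * y) := by
    rw [map_sub, Derivation.leibniz, hDyy, smul_eq_mul, smul_eq_mul, mul_one]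
    ring
  rw [e]
  exact Ideal.sub_mem _ (Ideal.sub_mem _ h5 (Ideal.mul_mem_right _ _ hym)) hq

end Summit.ResolutionOfSingularities.ResolutionOfSingularities.Theorems.PfaffLine
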